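import Literature.Topology.FourManifolds.PlanarArch
import HarnessLib

/-!
# Planar arches with a plateau (explicit formula)

Topic `Literature/Topology/FourManifolds` (trunk T-4MAN). Infrastructure for the fact seat
`provefact-Literature.Topology.FourManifolds.Knot.IsConnectedSum.isIsotopic` (Schubert's theorem):
the arches of `PlanarArch.lean` (`exists_planarArch`) are only available through an existential
statement, so that nothing beyond their specification is known about the chosen arches `cLo`, `cUp`
of `BandRebuildArches.lean` — in particular not the shape of their middle portion. The proof of the
geometric heart needs arches whose middle portion is *known*: here they are, as an explicit
definition with the same specification and more.

`Literature.Topology.FourManifolds.plateauArch θ₁ θ₂ ε y f g` is the planar curve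
`θ ↦ (χ₁ θ, (1 - χa θ) f θ + χa θ ((1 - χb θ) y + χb θ g θ))` built from the smooth steps
(`Literature.Topology.FourManifolds.smoothStep`) `χ₁` from `θ₁ + ε` to `θ₂ - ε`, `χa` from
`θ₁ + 3ε/2` to `θ₁ + 2ε` and `χb` from `θ₂ - 2ε` to `θ₂ - 3ε/2`. Granted `0 < ε`,
`θ₁ + 2ε < θ₂ - 2ε`, `f' > 0` left of `θ₁ + 2ε` and `g' < 0` right of `θ₂ - 2ε`:

* it is `C^∞` (`contDiff_plateauArch`), equals `(0, f θ)` for `θ ≤ θ₁ + ε` and `(1, g θ)` for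
  `θ ≥ θ₂ - ε` (`plateauArch_of_le`, `plateauArch_of_ge`); its first coordinate is `χ₁ θ`, in
  `(0, 1)` strictly between and in `[0, 1]` always, **strictly increasing on `[θ₁ + ε, θ₂ - ε]`**
  (`strictMonoOn_plateauArch_zero`); its second coordinate lies between the least and the largest
  of `f θ`, `y`, `g θ` (`plateauArch_one_mem_Icc`) and **equals `y` on the plateau
  `[θ₁ + 2ε, θ₂ - 2ε]`** (`plateauArch_one_of_mem_plateau`);
* it is injective (`injective_plateauArch`) and regular (`deriv_plateauArch_ne_zero`).

Everything is proved; the proofs are those of `exists_planarArch` with one more step function.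

## References

Standard; all statements `[folklore]`.
-/

open scoped ContDiff Topology
open Function Set Real

noncomputable section

namespace Literature.Topology.FourManifolds

/-- Local notation: `𝔼 n` is the model Euclidean space `EuclideanSpace ℝ (Fin n)`. -/
local notation "𝔼 " n:arg => EuclideanSpace ℝ (Fin n)

section PlateauArch

variable (θ₁ θ₂ ε y : ℝ) (f g : ℝ → ℝ)

/-- The height profile of the plateau arch: `f`, blended to the constant `y`, blended to `g`.
[folklore] -/
def plateauHeight (θ : ℝ) : ℝ :=
  (1 - smoothStep (θ₁ + 3 / 2 * ε) (θ₁ + 2 * ε) θ) * f θ +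
    smoothStep (θ₁ + 3 / 2 * ε) (θ₁ + 2 * ε) θ *
      ((1 - smoothStep (θ₂ - 2 * ε) (θ₂ - 3 / 2 * ε) θ) * y + smoothStep (θ₂ - 2 * ε) (θ₂ - 3 / 2 * ε) θ * g θ)

/-- **The plateau arch** `θ ↦ (χ₁ θ, plateauHeight θ)`: up the left edge along `f`, across the
square at the constant height `y` with strictly increasing first coordinate, down the right edge
along `g`. [folklore] -/
def plateauArch (θ : ℝ) : 𝔼 2 :=
  pt2 (smoothStep (θ₁ + ε) (θ₂ - ε) θ) (plateauHeight θ₁ θ₂ ε y f g θ)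

/-- First coordinate of the plateau arch. [folklore] -/
@[simp] theorem plateauArch_apply_zero (θ : ℝ) :
    plateauArch θ₁ θ₂ ε y f g θ 0 = smoothStep (θ₁ + ε) (θ₂ - ε) θ := rfl

/-- Second coordinate of the plateau arch. [folklore] -/
@[simp] theorem plateauArch_apply_one (θ : ℝ) :
    plateauArch θ₁ θ₂ ε y f g θ 1 = plateauHeight θ₁ θ₂ ε y f g θ := rfl

variable {θ₁ θ₂ ε y f g}

/-- The height profile is `C^∞`. [folklore] -/
theorem contDiff_plateauHeight (hf : ContDiff ℝ ∞ f) (hg : ContDiff ℝ ∞ g) :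
    ContDiff ℝ ∞ (plateauHeight θ₁ θ₂ ε y f g) := by
  have ha := contDiff_smoothStep (θ₁ + 3 / 2 * ε) (θ₁ + 2 * ε)
  have hb := contDiff_smoothStep (θ₂ - 2 * ε) (θ₂ - 3 / 2 * ε)
  exact ((contDiff_const.sub ha).mul hf).add
    (ha.mul (((contDiff_const.sub hb).mul contDiff_const).add (hb.mul hg)))

/-- **The plateau arch is `C^∞`.** [folklore] -/
theorem contDiff_plateauArch (hf : ContDiff ℝ ∞ f) (hg : ContDiff ℝ ∞ g) :
    ContDiff ℝ ∞ (plateauArch θ₁ θ₂ ε y f g) := by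
  rw [contDiff_euclidean]
  intro i
  fin_cases i
  · exact contDiff_smoothStep _ _
  · exact contDiff_plateauHeight hf hg

/-- Left of `θ₁ + 3ε/2` the height profile is `f`. [folklore] -/
theorem plateauHeight_of_le_left (hε : 0 < ε) {θ : ℝ} (hθ : θ ≤ θ₁ + 3 / 2 * ε) :
    plateauHeight θ₁ θ₂ ε y f g θ = f θ := by
  have h : θ₁ + 3 / 2 * ε < θ₁ + 2 * ε := by linarith
  simp only [plateauHeight, smoothStep_of_le h hθ]; ring

/-- Right of `θ₂ - 3ε/2` the height profile is `g`. [folklore] -/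
theorem plateauHeight_of_ge_right (hε : 0 < ε) (hθ₁₂ : θ₁ + 2 * ε < θ₂ - 2 * ε) {θ : ℝ}
    (hθ : θ₂ - 3 / 2 * ε ≤ θ) : plateauHeight θ₁ θ₂ ε y f g θ = g θ := by
  have ha : θ₁ + 3 / 2 * ε < θ₁ + 2 * ε := by linarith
  have hb : θ₂ - 2 * ε < θ₂ - 3 / 2 * ε := by linarith
  simp only [plateauHeight, smoothStep_of_ge ha (show θ₁ + 2 * ε ≤ θ by linarith), smoothStep_of_ge hb hθ]
  ring

/-- **On the plateau `[θ₁ + 2ε, θ₂ - 2ε]` the height is the constant `y`.** [folklore] -/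
theorem plateauHeight_of_mem_plateau (hε : 0 < ε) {θ : ℝ} (hθ : θ ∈ Icc (θ₁ + 2 * ε) (θ₂ - 2 * ε)) :
    plateauHeight θ₁ θ₂ ε y f g θ = y := by
  have ha : θ₁ + 3 / 2 * ε < θ₁ + 2 * ε := by linarith
  have hb : θ₂ - 2 * ε < θ₂ - 3 / 2 * ε := by linarith
  simp only [plateauHeight, smoothStep_of_ge ha hθ.1, smoothStep_of_le hb hθ.2]
  ring

/-- **Left end**: for `θ ≤ θ₁ + ε` the arch is `(0, f θ)`. [folklore] -/
theorem plateauArch_of_le (hε : 0 < ε) (hθ₁₂ : θ₁ + 2 * ε < θ₂ - 2 * ε) {θ : ℝ} (hθ : θ ≤ θ₁ + ε) :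
    plateauArch θ₁ θ₂ ε y f g θ = pt2 0 (f θ) := by
  have h1 : θ₁ + ε < θ₂ - ε := by linarith
  simp only [plateauArch, smoothStep_of_le h1 hθ, plateauHeight_of_le_left hε (show θ ≤ θ₁ + 3 / 2 * ε by linarith)]

/-- **Right end**: for `θ₂ - ε ≤ θ` the arch is `(1, g θ)`. [folklore] -/
theorem plateauArch_of_ge (hε : 0 < ε) (hθ₁₂ : θ₁ + 2 * ε < θ₂ - 2 * ε) {θ : ℝ} (hθ : θ₂ - ε ≤ θ) :
    plateauArch θ₁ θ₂ ε y f g θ = pt2 1 (g θ) := by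
  have h1 : θ₁ + ε < θ₂ - ε := by linarith
  simp only [plateauArch, smoothStep_of_ge h1 hθ,
    plateauHeight_of_ge_right hε hθ₁₂ (show θ₂ - 3 / 2 * ε ≤ θ by linarith)]

/-- **On the plateau** the arch is `(χ₁ θ, y)`. [folklore] -/
theorem plateauArch_of_mem_plateau (hε : 0 < ε) {θ : ℝ} (hθ : θ ∈ Icc (θ₁ + 2 * ε) (θ₂ - 2 * ε)) :
    plateauArch θ₁ θ₂ ε y f g θ = pt2 (smoothStep (θ₁ + ε) (θ₂ - ε) θ) y := by
  simp only [plateauArch, plateauHeight_of_mem_plateau hε hθ]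

/-- The second coordinate on the plateau. [folklore] -/
theorem plateauArch_one_of_mem_plateau (hε : 0 < ε) {θ : ℝ} (hθ : θ ∈ Icc (θ₁ + 2 * ε) (θ₂ - 2 * ε)) :
    plateauArch θ₁ θ₂ ε y f g θ 1 = y := by
  rw [plateauArch_apply_one, plateauHeight_of_mem_plateau hε hθ]

/-- Strictly inside, the first coordinate lies in `(0, 1)`. [folklore] -/
theorem plateauArch_zero_mem_Ioo (hε : 0 < ε) (hθ₁₂ : θ₁ + 2 * ε < θ₂ - 2 * ε) {θ : ℝ}
    (hθ : θ ∈ Ioo (θ₁ + ε) (θ₂ - ε)) : plateauArch θ₁ θ₂ ε y f g θ 0 ∈ Ioo (0 : ℝ) 1 := by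
  rw [plateauArch_apply_zero]
  exact smoothStep_mem_Ioo (by linarith) hθ

/-- The first coordinate always lies in `[0, 1]`. [folklore] -/
theorem plateauArch_zero_mem_Icc (θ : ℝ) : plateauArch θ₁ θ₂ ε y f g θ 0 ∈ Icc (0 : ℝ) 1 := by
  rw [plateauArch_apply_zero]
  exact smoothStep_mem_Icc _ _ _

/-- **The first coordinate is strictly increasing across the square.** [folklore] -/
theorem strictMonoOn_plateauArch_zero (hε : 0 < ε) (hθ₁₂ : θ₁ + 2 * ε < θ₂ - 2 * ε) :
    StrictMonoOn (fun θ ↦ plateauArch θ₁ θ₂ ε y f g θ 0) (Icc (θ₁ + ε) (θ₂ - ε)) := by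
  simp only [plateauArch_apply_zero]
  exact strictMonoOn_smoothStep (by linarith)

/-- The derivative of the first coordinate is positive strictly inside. [folklore] -/
theorem deriv_plateauArch_zero_pos (hε : 0 < ε) (hθ₁₂ : θ₁ + 2 * ε < θ₂ - 2 * ε) {θ : ℝ}
    (hθ : θ ∈ Ioo (θ₁ + ε) (θ₂ - ε)) : 0 < deriv (fun θ ↦ plateauArch θ₁ θ₂ ε y f g θ 0) θ := by
  simp only [plateauArch_apply_zero]
  exact deriv_smoothStep_pos (by linarith) hθ

/-- A convex combination lies between the least and the largest of its terms. [folklore] -/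
theorem combo_mem_Icc_min_max {lam p q : ℝ} (h0 : 0 ≤ lam) (h1 : lam ≤ 1) :
    (1 - lam) * p + lam * q ∈ Icc (min p q) (max p q) := by
  have h := combo_mem_uIcc (p := p) (q := q) h0 h1
  rwa [uIcc] at h

/-- **Heights of the plateau arch**: the second coordinate lies between the least and the largest
of `f θ`, `y`, `g θ`. [folklore] -/
theorem plateauArch_one_mem_Icc (θ : ℝ) :
    plateauArch θ₁ θ₂ ε y f g θ 1 ∈ Icc (min (f θ) (min y (g θ))) (max (f θ) (max y (g θ))) := by
  rw [plateauArch_apply_one, plateauHeight]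
  set a := smoothStep (θ₁ + 3 / 2 * ε) (θ₁ + 2 * ε) θ
  set c := smoothStep (θ₂ - 2 * ε) (θ₂ - 3 / 2 * ε) θ
  have ha := smoothStep_mem_Icc (θ₁ + 3 / 2 * ε) (θ₁ + 2 * ε) θ
  have hc := smoothStep_mem_Icc (θ₂ - 2 * ε) (θ₂ - 3 / 2 * ε) θ
  have hw := combo_mem_Icc_min_max (p := y) (q := g θ) hc.1 hc.2
  have hv := combo_mem_Icc_min_max (p := f θ) (q := (1 - c) * y + c * g θ) ha.1 ha.2
  constructor
  · refine le_trans ?_ hv.1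
    exact le_min (min_le_left _ _) ((min_le_right _ _).trans hw.1)
  · refine hv.2.trans ?_
    exact max_le (le_max_left _ _) (hw.2.trans (le_max_right _ _))

/-- **The plateau arch is injective** (on the ends the height is strictly monotone, across the
square the first coordinate is). [folklore] -/
theorem injective_plateauArch (hε : 0 < ε) (hθ₁₂ : θ₁ + 2 * ε < θ₂ - 2 * ε) (hf : ContDiff ℝ ∞ f)
    (hg : ContDiff ℝ ∞ g) (hf' : ∀ θ, θ ≤ θ₁ + 2 * ε → 0 < deriv f θ)
    (hg' : ∀ θ, θ₂ - 2 * ε ≤ θ → deriv g θ < 0) : Injective (plateauArch θ₁ θ₂ ε y f g) := by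
  have h1 : θ₁ + ε < θ₂ - ε := by linarith
  set c := plateauArch θ₁ θ₂ ε y f g with hc
  set χ₁ := smoothStep (θ₁ + ε) (θ₂ - ε) with hχ₁
  have hc0 : ∀ θ, c θ 0 = χ₁ θ := fun θ ↦ rfl
  have hleft : ∀ θ, θ ≤ θ₁ + ε → c θ = pt2 0 (f θ) := fun θ hθ ↦ plateauArch_of_le hε hθ₁₂ hθ
  have hright : ∀ θ, θ₂ - ε ≤ θ → c θ = pt2 1 (g θ) := fun θ hθ ↦ plateauArch_of_ge hε hθ₁₂ hθ
  have hχ₁0 : ∀ θ, θ ≤ θ₁ + ε → χ₁ θ = 0 := fun θ hθ' ↦ smoothStep_of_le h1 hθ'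
  have hχ₁1 : ∀ θ, θ₂ - ε ≤ θ → χ₁ θ = 1 := fun θ hθ' ↦ smoothStep_of_ge h1 hθ'
  have hfm : StrictMonoOn f (Iic (θ₁ + 2 * ε)) := by
    refine strictMonoOn_of_deriv_pos (convex_Iic _) hf.continuous.continuousOn fun x hx ↦ ?_
    rw [interior_Iic] at hx
    exact hf' x (le_of_lt hx)
  have hgm : StrictAntiOn g (Ici (θ₂ - 2 * ε)) := by
    refine strictAntiOn_of_deriv_neg (convex_Ici _) hg.continuous.continuousOn fun x hx ↦ ?_
    rw [interior_Ici] at hx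
    exact hg' x (le_of_lt hx)
  have hχ₁m : StrictMonoOn χ₁ (Icc (θ₁ + ε) (θ₂ - ε)) := strictMonoOn_smoothStep h1
  have key : ∀ s t, s < t → c s ≠ c t := by
    intro s t hst heq
    have hu : χ₁ s = χ₁ t := by rw [← hc0, ← hc0, heq]
    by_cases hA : t ≤ θ₁ + ε
    · have := hfm (show s ∈ Iic (θ₁ + 2 * ε) by simp only [mem_Iic]; linarith)
        (show t ∈ Iic (θ₁ + 2 * ε) by simp only [mem_Iic]; linarith) hst
      rw [hleft s (by linarith), hleft t hA] at heq
      have h1' : f s = f t := by simpa using congrArg (fun w : 𝔼 2 ↦ w 1) heq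
      exact this.ne h1'
    by_cases hB : θ₂ - ε ≤ s
    · have := hgm (show s ∈ Ici (θ₂ - 2 * ε) by simp only [mem_Ici]; linarith)
        (show t ∈ Ici (θ₂ - 2 * ε) by simp only [mem_Ici]; linarith) hst
      rw [hright s hB, hright t (by linarith)] at heq
      have h1' : g s = g t := by simpa using congrArg (fun w : 𝔼 2 ↦ w 1) heq
      exact this.ne' h1'
    push Not at hA hB
    have hs' : χ₁ s = χ₁ (max s (θ₁ + ε)) := by
      rcases le_total s (θ₁ + ε) with h | h
      · rw [max_eq_right h, hχ₁0 s h, hχ₁0 _ le_rfl]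
      · rw [max_eq_left h]
    have ht' : χ₁ t = χ₁ (min t (θ₂ - ε)) := by
      rcases le_total t (θ₂ - ε) with h | h
      · rw [min_eq_left h]
      · rw [min_eq_right h, hχ₁1 t h, hχ₁1 _ le_rfl]
    have hlt : max s (θ₁ + ε) < min t (θ₂ - ε) :=
      lt_min (max_lt hst hA) (max_lt hB h1)
    have := hχ₁m ⟨le_max_right _ _, (le_of_lt hlt).trans (min_le_right _ _)⟩
      ⟨(le_max_right _ _).trans (le_of_lt hlt), min_le_right _ _⟩ hlt
    rw [← hs', ← ht'] at this
    exact this.ne hu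
  intro s t hst
  rcases lt_trichotomy s t with h | h | h
  · exact absurd hst (key s t h)
  · exact h
  · exact absurd hst.symm (key t s h)

/-- The derivative of the plateau arch. [folklore] -/
theorem hasDerivAt_plateauArch (hf : ContDiff ℝ ∞ f) (hg : ContDiff ℝ ∞ g) (θ : ℝ) :
    HasDerivAt (plateauArch θ₁ θ₂ ε y f g)
      (pt2 (deriv (smoothStep (θ₁ + ε) (θ₂ - ε)) θ) (deriv (plateauHeight θ₁ θ₂ ε y f g) θ)) θ :=
  hasDerivAt_pt2 ((differentiable_smoothStep _ _ θ).hasDerivAt)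
    (((contDiff_plateauHeight hf hg).differentiable (by simp) θ).hasDerivAt)

/-- **The plateau arch is regular.** [folklore] -/
theorem deriv_plateauArch_ne_zero (hε : 0 < ε) (hθ₁₂ : θ₁ + 2 * ε < θ₂ - 2 * ε) (hf : ContDiff ℝ ∞ f)
    (hg : ContDiff ℝ ∞ g) (hf' : ∀ θ, θ ≤ θ₁ + 2 * ε → 0 < deriv f θ)
    (hg' : ∀ θ, θ₂ - 2 * ε ≤ θ → deriv g θ < 0) (θ : ℝ) : deriv (plateauArch θ₁ θ₂ ε y f g) θ ≠ 0 := by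
  have h1 : θ₁ + ε < θ₂ - ε := by linarith
  intro h0
  rw [(hasDerivAt_plateauArch hf hg θ).deriv] at h0
  have hd0 : deriv (smoothStep (θ₁ + ε) (θ₂ - ε)) θ = 0 := by simpa using congrArg (fun w : 𝔼 2 ↦ w 0) h0
  have hd1 : deriv (plateauHeight θ₁ θ₂ ε y f g) θ = 0 := by simpa using congrArg (fun w : 𝔼 2 ↦ w 1) h0
  by_cases hA : θ < θ₁ + 3 / 2 * ε
  · have hev : plateauHeight θ₁ θ₂ ε y f g =ᶠ[𝓝 θ] f :=
      Filter.eventuallyEq_of_mem (Iio_mem_nhds hA) fun x hx ↦ plateauHeight_of_le_left hε (le_of_lt hx)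
    rw [hev.deriv_eq] at hd1
    exact (hf' θ (by linarith)).ne' hd1
  by_cases hB : θ₂ - 3 / 2 * ε < θ
  · have hev : plateauHeight θ₁ θ₂ ε y f g =ᶠ[𝓝 θ] g :=
      Filter.eventuallyEq_of_mem (Ioi_mem_nhds hB) fun x hx ↦ plateauHeight_of_ge_right hε hθ₁₂ (le_of_lt hx)
    rw [hev.deriv_eq] at hd1
    exact (hg' θ (by linarith)).ne hd1
  push Not at hA hB
  exact (deriv_smoothStep_pos h1 ⟨by linarith, by linarith⟩).ne' hd0

/-- **The plateau arch satisfies the specification of `exists_planarArch`** (with the height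
clause in min/max form), so that it can replace the chosen arches wherever only the specification
is used. [folklore] -/
theorem plateauArch_spec (hε : 0 < ε) (hθ₁₂ : θ₁ + 2 * ε < θ₂ - 2 * ε) (hf : ContDiff ℝ ∞ f)
    (hg : ContDiff ℝ ∞ g) (hf' : ∀ θ, θ ≤ θ₁ + 2 * ε → 0 < deriv f θ)
    (hg' : ∀ θ, θ₂ - 2 * ε ≤ θ → deriv g θ < 0) :
    ContDiff ℝ ∞ (plateauArch θ₁ θ₂ ε y f g) ∧
      (∀ θ, θ ≤ θ₁ + ε → plateauArch θ₁ θ₂ ε y f g θ = pt2 0 (f θ)) ∧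
      (∀ θ, θ₂ - ε ≤ θ → plateauArch θ₁ θ₂ ε y f g θ = pt2 1 (g θ)) ∧
      (∀ θ ∈ Ioo (θ₁ + ε) (θ₂ - ε), plateauArch θ₁ θ₂ ε y f g θ 0 ∈ Ioo (0 : ℝ) 1) ∧
      (∀ θ, plateauArch θ₁ θ₂ ε y f g θ 0 ∈ Icc (0 : ℝ) 1) ∧
      (∀ θ, plateauArch θ₁ θ₂ ε y f g θ 1 ∈ Icc (min (f θ) (min y (g θ))) (max (f θ) (max y (g θ)))) ∧
      Injective (plateauArch θ₁ θ₂ ε y f g) ∧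
      ∀ θ, deriv (plateauArch θ₁ θ₂ ε y f g) θ ≠ 0 :=
  ⟨contDiff_plateauArch hf hg, fun _ h ↦ plateauArch_of_le hε hθ₁₂ h,
    fun _ h ↦ plateauArch_of_ge hε hθ₁₂ h, fun _ h ↦ plateauArch_zero_mem_Ioo hε hθ₁₂ h,
    plateauArch_zero_mem_Icc, plateauArch_one_mem_Icc,
    injective_plateauArch hε hθ₁₂ hf hg hf' hg', deriv_plateauArch_ne_zero hε hθ₁₂ hf hg hf' hg'⟩

end PlateauArch

end Literature.Topology.FourManifolds
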